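import Summits.NavierStokesRegularity.FluidComputer.ClayBlowupLocalZoom
import Summits.NavierStokesRegularity.FluidComputer.ClayBlowupForcedAxisDecay
import Literature.Analysis.FluidPDE.AncientL3BackwardLiouvilleHolds
import Literature.Analysis.FluidPDE.BarkerPrangeConcentrationProofs
import HarnessLib

/-!
# LOCAL ESS WITH THE CLAY FORCE: `L³` concentrates at EVERY singular point of a Clay blow-up, WITH
# its Clay force (viscosity `1` core, then every viscosity)

Cell `ns-blowup`, seat `ns-blowup-ecbridge-2` (g11; the E–C endpoint theory seat). LABEL: E–C typing
(KERNEL — no named fact, no new definition). WHAT THIS IS NOT: not Navier–Stokes evidence — a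
necessary condition at each singular point of the TYPE `ClayBlowup ν`; no inhabitant is claimed.
Companion memo: `run/shared/lean/pub/ns-blowup/ecbridge2/ECBRIDGE-2-MEMO-10.md`.

## Content

g7's `ClayBlowup.L3_concentration` (Escauriaza–Seregin–Šverák's Thm. 1.4 at the top of a backward
cylinder: a LOCAL `L^∞_t L³_x` bound near `(T, x₀)` makes `x₀` regular) carries `hf : X.f = 0` — the
tree's ESS local theorem is unforced; g10's `limsup_eLpNorm_three_eq_top_forced` is only the GLOBAL
row. This file puts the force into the LOCAL row WITHOUT a forced ESS brick, through the LOCAL ZOOM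
(`exists_local_zoom_limit`): if `∫_{B_r(x₀)} |u(t)|³ ≤ C` for all `t ∈ (T − r², T)` and `x₀` were
singular, the local zooms at `x₀` — centred at `y_k ∈ B(x₀, r/2)` with scales `M_k⁻¹ → 0` — would have
`L³` norms `≤ C^{1/3}` on the balls `B(0, r M_k/2)` (scale invariance of `L³` on balls,
`eLpNorm_comp_add_smul_ball`), so every slice of the nontrivial bounded ancient mild limit `W` has
`‖W(s)‖₃ ≤ C^{1/3}` (Fatou), and `W ≡ 0` by Albritton–Barker's backward-`L³` Liouville theorem
(`AlbrittonBarker2019_liouville_L3_backward_holds`) — against `‖W(s, 0)‖ ≥ 1/2` near the vertex.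

* `ClayBlowup.isBackwardBoundedAt_of_L3_bound_forced_one` — (`X : ClayBlowup 1`) a local
  `L^∞_t L³_x` bound on `(T − r², T) × B_r(x₀)` (every `t`) makes `x₀` backward bounded;
* `ClayBlowup.L3_concentration_forced_one` — at a point which is NOT backward bounded, for every
  `r` (`r² ≤ T`) and every `C` some `t ∈ (T − r², T)` has `∫_{B_r(x₀)} |u(t)|³ > C`;
* `ClayBlowup.isBackwardBoundedAt_of_L3_bound_forced`, `ClayBlowup.L3_concentration_forced` — every
  viscosity `ν > 0` (the normalisation `rescale` is a time dilation); `DesignedBlowup` twin.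
So the K3 row of the census is now LOCAL AND FORCED: `L³` concentrates at every point of the singular
slice of every (C)-certificate by blow-up, with its force (g7: unforced; g10: global limsup, forced).

References: L. Escauriaza, G. Seregin, V. Šverák, Russ. Math. Surveys 58 (2003), Thm. 1.4
[cite: EscauriazaSereginSverak2003, Thm. 1.4]; D. Albritton, T. Barker, J. Math. Fluid Mech. 21 (2019),
Thm. 1.2 [cite: AlbrittonBarker2019, Thm 1.2]; Koch–Nadirashvili–Seregin–Šverák, Acta Math. 203
(2009), §6 [cite: KochNadirashviliSereginSverak2009, Prop 6.1].
-/

noncomputable section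

namespace Summit.NavierStokesRegularity.FluidComputer

open Set MeasureTheory Filter Topology Function Metric Real
open scoped ENNReal NNReal
open Literature.Analysis Literature.Analysis.FluidPDE
open Summit.NavierStokesRegularity.NavierStokesRegularity

/-- **`L³` scale invariance of zoom slices on balls**: the `L³` norm of `z ↦ c • F(y₀ + c z)` on
`B(0, ρ)` equals the `L³` norm of `F` on `B(y₀, c ρ)` (`c > 0`). [cite: EscauriazaSereginSverak2003, §3 (scale invariance)] -/
theorem eLpNorm_three_zoom_ball {c : ℝ} (hc : 0 < c) (y₀ : EuclideanSpace ℝ (Fin 3))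
    (F : EuclideanSpace ℝ (Fin 3) → EuclideanSpace ℝ (Fin 3)) (ρ : ℝ) :
    eLpNorm (fun z => c • F (y₀ + c • z)) 3 (volume.restrict (ball (0 : EuclideanSpace ℝ (Fin 3)) ρ)) =
      eLpNorm F 3 (volume.restrict (ball y₀ (c * ρ))) := by
  have h1 : (fun z => c • F (y₀ + c • z)) = c • fun z => F (y₀ + c • z) := rfl
  rw [h1, eLpNorm_const_smul, eLpNorm_comp_add_smul_ball F y₀ 0 hc ρ (by norm_num : (3 : ℝ≥0∞) ≠ ⊤),
    smul_zero, add_zero, ← mul_assoc]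
  have h2 : ‖c‖ₑ * ENNReal.ofReal (c ^ 3)⁻¹ ^ (1 / (3 : ℝ≥0∞)).toReal = 1 := by
    have h3 : ((c ^ 3)⁻¹) ^ ((1 : ℝ) / 3) = c⁻¹ := by
      rw [Real.inv_rpow (by positivity), show (c ^ 3 : ℝ) = c ^ (3 : ℝ) by norm_cast,
        ← Real.rpow_mul hc.le]
      norm_num
    have h4 : ENNReal.ofReal (c ^ 3)⁻¹ ^ ((1 : ℝ) / 3) = ENNReal.ofReal c⁻¹ := by
      rw [ENNReal.ofReal_rpow_of_nonneg (by positivity) (by norm_num), h3]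
    rw [Real.enorm_eq_ofReal hc.le, ENNReal.toReal_div, ENNReal.toReal_one, ENNReal.toReal_ofNat, h4,
      ← ENNReal.ofReal_mul hc.le, mul_inv_cancel₀ hc.ne', ENNReal.ofReal_one]
  rw [h2, one_mul]

namespace ClayBlowup

set_option maxHeartbeats 400000 in
-- Fatou + Albritton–Barker assembled on the local zoom
/-- **LOCAL ESS WITH THE CLAY FORCE, VISCOSITY ONE**: if `∫_{B_r(x₀)} |u(t)|³ ≤ C` for every
`t ∈ (T − r², T)` (`0 < r`, `r² ≤ T`), then `u` is backward bounded at `(T, x₀)` — for EVERY Clay force.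
[cite: EscauriazaSereginSverak2003, Thm. 1.4] [cite: AlbrittonBarker2019, Thm 1.2] -/
theorem isBackwardBoundedAt_of_L3_bound_forced_one (X : ClayBlowup 1)
    {x₀ : EuclideanSpace ℝ (Fin 3)} {r : ℝ} (hr : 0 < r) (hrT : r ^ 2 ≤ X.T) {C : ℝ≥0}
    (hL3 : ∀ t ∈ Ioo (X.T - r ^ 2) X.T, ∫⁻ x in ball x₀ r, ‖X.u t x‖ₑ ^ 3 ≤ C) :
    IsBackwardBoundedAt X.u X.T x₀ := by
  by_contra hx₀
  have hT := X.T_pos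
  -- ### the local zoom at `x₀`: centres in `B(x₀, r')`, base time `T − r²/2`
  set r' : ℝ := min (r / 2) 1 with hr'
  have hr'0 : 0 < r' := lt_min (by positivity) one_pos
  have hr'1 : r' ≤ 1 := min_le_right _ _
  have hr'r : r' ≤ r / 2 := min_le_left _ _
  set t_b : ℝ := X.T - r ^ 2 / 2 with ht_b
  have htb : t_b ∈ Ico 0 X.T := ⟨by rw [ht_b]; linarith, by rw [ht_b]; nlinarith⟩
  obtain ⟨τ, y, φ, W, hφ, hτ, hy, hk1, hWc, hWdiv, hWmild, hWbd, ⟨σ₁, hσ₁, hvert⟩, hconv⟩ :=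
    X.exists_local_zoom_limit hx₀ hr'0 hr'1 htb
  set M : ℕ → ℝ := fun k => ‖X.u (τ k) (y k)‖ with hM
  have hM0 : ∀ k, 0 < M k := fun k => lt_of_lt_of_le (by positivity) (hk1 k)
  have hc0 : ∀ k, 0 < (M k)⁻¹ := fun k => inv_pos.2 (hM0 k)
  have hcto : Tendsto (fun j => (M (φ j))⁻¹) atTop (𝓝 0) := by
    have hMto : Tendsto M atTop atTop := by
      refine tendsto_atTop_atTop.2 fun b => ⟨⌈b⌉₊, fun k hk => ?_⟩
      have h1 : (⌈b⌉₊ : ℝ) ≤ k := by exact_mod_cast hk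
      linarith [Nat.le_ceil b, hk1 k]
    exact tendsto_inv_atTop_zero.comp (hMto.comp hφ.tendsto_atTop)
  -- ### every slice of `W` has `‖W(s)‖₃ ≤ C^{1/3}`
  have hyr : ∀ k, ball (y k) (r / 2) ⊆ ball x₀ r := by
    intro k z hz
    rw [mem_ball] at hz ⊢
    have := mem_ball.1 (hy k)
    calc dist z x₀ ≤ dist z (y k) + dist (y k) x₀ := dist_triangle _ _ _
      _ < r / 2 + r / 2 := add_lt_add hz (this.trans_le hr'r)
      _ = r := by ring
  have hA : ∀ s < 0, eLpNorm (W s) 3 volume ≤ (C : ℝ≥0∞) ^ (1 / 3 : ℝ) := by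
    intro s hs
    set c : ℕ → ℝ := fun j => (M (φ j))⁻¹ with hc
    have hcpos : ∀ j, 0 < c j := fun j => hc0 (φ j)
    -- the slice times are valid from some `J` on
    have htime : ∀ᶠ j in atTop, τ (φ j) + c j ^ 2 * s ∈ Ioo (X.T - r ^ 2) X.T := by
      have h2 : Tendsto (fun j => c j ^ 2 * s) atTop (𝓝 0) := by
        simpa using (hcto.pow 2).mul_const s
      have hr2 : 0 < r ^ 2 := by positivity
      filter_upwards [h2.eventually (Ioo_mem_nhds (show -(r ^ 2 / 2) < (0 : ℝ) by linarith) one_pos)]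
        with j hj
      have h3 : c j ^ 2 * s ≤ 0 := mul_nonpos_of_nonneg_of_nonpos (sq_nonneg _) hs.le
      have h4 := (hτ (φ j)).1
      have h5 := (hτ (φ j)).2
      simp only [ht_b] at h4
      exact ⟨by linarith [hj.1], by linarith⟩
    obtain ⟨J, hJ⟩ := eventually_atTop.1 htime
    set ρ : ℕ → ℝ := fun n => (r / 2) * M (φ (n + J)) with hρ
    set f : ℕ → EuclideanSpace ℝ (Fin 3) → EuclideanSpace ℝ (Fin 3) := fun n =>
      (ball (0 : EuclideanSpace ℝ (Fin 3)) (ρ n)).indicator fun z =>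
        c (n + J) • X.u (τ (φ (n + J)) + c (n + J) ^ 2 * s) (y (φ (n + J)) + c (n + J) • z) with hf
    have hvalid : ∀ n, τ (φ (n + J)) + c (n + J) ^ 2 * s ∈ Ioo (X.T - r ^ 2) X.T := fun n =>
      hJ (n + J) (Nat.le_add_left J n)
    have hfm : ∀ n, AEStronglyMeasurable (f n) volume := by
      intro n
      have hv := hvalid n
      have hcd := X.classical.contDiff_velocity (t := τ (φ (n + J)) + c (n + J) ^ 2 * s)
        ⟨by linarith [hv.1, hrT], hv.2⟩
      have haff : Continuous (fun z : EuclideanSpace ℝ (Fin 3) => y (φ (n + J)) + c (n + J) • z) :=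
        continuous_const.add (continuous_id.const_smul (c (n + J)))
      exact ((hcd.continuous.comp haff).const_smul (c (n + J))).aestronglyMeasurable.indicator
        measurableSet_ball
    -- pointwise convergence to `W(s)`: eventually `z ∈ B(0, ρ_n)`
    have hρlim : Tendsto ρ atTop atTop := by
      have hMto : Tendsto (fun n => M (φ (n + J))) atTop atTop := by
        refine tendsto_atTop_atTop.2 fun b => ⟨⌈b⌉₊, fun n hn => ?_⟩
        have h1 : (⌈b⌉₊ : ℝ) ≤ n := by exact_mod_cast hn
        have h2 : (n : ℝ) ≤ φ (n + J) := by exact_mod_cast (hφ.id_le (n + J)).trans' (Nat.le_add_right n J)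
        linarith [Nat.le_ceil b, hk1 (φ (n + J))]
      exact hMto.const_mul_atTop (by positivity)
    have hflim : ∀ z, Tendsto (fun n => f n z) atTop (𝓝 (W s z)) := by
      intro z
      have h1 : Tendsto (fun n => c (n + J) • X.u (τ (φ (n + J)) + c (n + J) ^ 2 * s)
          (y (φ (n + J)) + c (n + J) • z)) atTop (𝓝 (W s z)) :=
        (hconv s hs z).comp (tendsto_add_atTop_nat J)
      refine h1.congr' ?_
      filter_upwards [hρlim.eventually (eventually_gt_atTop ‖z‖)] with n hn
      simp only [hf, indicator_of_mem (mem_ball_zero_iff.2 hn)]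
    have hfat := MeasureTheory.Lp.eLpNorm_lim_le_liminf_eLpNorm (p := (3 : ℝ≥0∞)) hfm (W s)
      (Eventually.of_forall hflim)
    refine hfat.trans (Filter.liminf_le_of_frequently_le' (Eventually.of_forall fun n => ?_).frequently)
    -- the bound for each truncated slice
    have hcρ : c (n + J) * ρ n = r / 2 := by
      simp only [hc, hρ]; field_simp [(hM0 (φ (n + J))).ne']
    rw [hf, eLpNorm_indicator_eq_eLpNorm_restrict measurableSet_ball,
      eLpNorm_three_zoom_ball (hcpos _) _ _ _, hcρ]
    refine (eLpNorm_mono_measure _ (Measure.restrict_mono (hyr _) le_rfl)).trans ?_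
    rw [eLpNorm_eq_lintegral_rpow_enorm_toReal (by norm_num) (by norm_num), ENNReal.toReal_ofNat]
    refine ENNReal.rpow_le_rpow ?_ (by norm_num)
    have hv := hvalid n
    refine (le_of_eq (lintegral_congr fun x => ?_)).trans (hL3 _ hv)
    exact ENNReal.rpow_ofNat _ 3
  -- ### Albritton–Barker: `W ≡ 0` on `(−∞, 0)`
  have hCt : (C : ℝ≥0∞) ^ (1 / 3 : ℝ) < ⊤ := ENNReal.rpow_lt_top_of_nonneg (by norm_num) ENNReal.coe_ne_top
  have hzero : ∀ s < 0, ∀ z, W s z = 0 := by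
    refine AlbrittonBarker2019_liouville_L3_backward_holds hWc ⟨4, hWbd⟩ hWdiv hWmild
      ⟨fun k => -((k : ℝ) + 1), (C : ℝ≥0∞) ^ (1 / 3 : ℝ), hCt, ?_,
        fun k => by linarith [k.cast_nonneg (α := ℝ)],
        fun k => hA _ (by linarith [k.cast_nonneg (α := ℝ)])⟩
    exact tendsto_neg_atTop_atBot.comp
      (tendsto_atTop_add_const_right _ _ tendsto_natCast_atTop_atTop)
  -- ### the vertex contradicts
  have hs₀ : -(σ₁ / 2) ∈ Ioo (-σ₁) 0 := ⟨by linarith, by linarith⟩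
  have h := hvert _ hs₀
  rw [hzero _ (by linarith) 0, norm_zero] at h
  linarith

/-- **`L³` CONCENTRATES AT EVERY SINGULAR POINT, WITH THE CLAY FORCE (viscosity one)**: if `u` is not
backward bounded at `(T, x₀)`, then for every `0 < r` with `r² ≤ T` and every `C` there is
`t ∈ (T − r², T)` with `∫_{B_r(x₀)} |u(t)|³ > C`. [cite: EscauriazaSereginSverak2003, Thm. 1.4]
[cite: AlbrittonBarker2019, Thm 1.2] -/
theorem L3_concentration_forced_one (X : ClayBlowup 1) {x₀ : EuclideanSpace ℝ (Fin 3)}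
    (hx₀ : ¬ IsBackwardBoundedAt X.u X.T x₀) {r : ℝ} (hr : 0 < r) (hrT : r ^ 2 ≤ X.T) (C : ℝ≥0) :
    ∃ t ∈ Ioo (X.T - r ^ 2) X.T, (C : ℝ≥0∞) < ∫⁻ x in ball x₀ r, ‖X.u t x‖ₑ ^ 3 := by
  by_contra h
  push Not at h
  exact hx₀ (X.isBackwardBoundedAt_of_L3_bound_forced_one hr hrT h)

/-! ## §2 Every viscosity -/

/-- **LOCAL ESS WITH THE CLAY FORCE** (`ν > 0`, ANY Clay force; no named fact): if
`∫_{B_r(x₀)} |u(t)|³ ≤ C` for every `t ∈ (T − r², T)` (`0 < r`, `r² ≤ T`), then `u` is backward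
bounded at `(T, x₀)`. The viscosity normalisation `rescale` (`Y(s, x) = a u(a s, x)`, `a = 1/ν`) maps
backward cylinders at `(T/a, x₀)` to backward cylinders at `(T, x₀)` and multiplies local `L³` norms by
`a`. Supersedes g7's `isBackwardBoundedAt_of_L3_bound (hf : X.f = 0)` (a.e.-in-time form there; every
`t` here). [cite: EscauriazaSereginSverak2003, Thm. 1.4] [cite: AlbrittonBarker2019, Thm 1.2] -/
theorem isBackwardBoundedAt_of_L3_bound_forced {ν : ℝ} (X : ClayBlowup ν) (hν : 0 < ν)
    {x₀ : EuclideanSpace ℝ (Fin 3)} {r : ℝ} (hr : 0 < r) (hrT : r ^ 2 ≤ X.T) {C : ℝ≥0}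
    (hL3 : ∀ t ∈ Ioo (X.T - r ^ 2) X.T, ∫⁻ x in ball x₀ r, ‖X.u t x‖ₑ ^ 3 ≤ C) :
    IsBackwardBoundedAt X.u X.T x₀ := by
  have hT := X.T_pos
  set a : ℝ := 1 / ν with ha
  have ha0 : 0 < a := by positivity
  set Y : ClayBlowup 1 := X.rescale hν one_pos with hY
  have hYT : Y.T = X.T / a := X.rescale_T hν one_pos
  have hYu : ∀ s y, Y.u s y = a • X.u (a * s) y := fun s y => X.rescale_u_apply hν one_pos s y
  -- a radius `r₁` with `r₁ ≤ r`, `a r₁² ≤ r²`, `r₁² ≤ Y.T`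
  obtain ⟨r₁, hr₁0, hr₁r, hr₁a, hr₁T⟩ : ∃ r₁ : ℝ, 0 < r₁ ∧ r₁ ≤ r ∧ a * r₁ ^ 2 ≤ r ^ 2 ∧ r₁ ^ 2 ≤ Y.T := by
    refine ⟨min r (r / Real.sqrt a), lt_min hr (by positivity), min_le_left _ _, ?_, ?_⟩
    · have h1 : min r (r / Real.sqrt a) ^ 2 ≤ (r / Real.sqrt a) ^ 2 :=
        pow_le_pow_left₀ (le_min hr.le (by positivity)) (min_le_right _ _) 2
      have h2 : a * (r / Real.sqrt a) ^ 2 = r ^ 2 := by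
        rw [div_pow, Real.sq_sqrt ha0.le]; field_simp
      calc a * min r (r / Real.sqrt a) ^ 2 ≤ a * (r / Real.sqrt a) ^ 2 :=
            mul_le_mul_of_nonneg_left h1 ha0.le
        _ = r ^ 2 := h2
    · have h1 : min r (r / Real.sqrt a) ^ 2 ≤ (r / Real.sqrt a) ^ 2 :=
        pow_le_pow_left₀ (le_min hr.le (by positivity)) (min_le_right _ _) 2
      have h2 : (r / Real.sqrt a) ^ 2 = r ^ 2 / a := by rw [div_pow, Real.sq_sqrt ha0.le]
      rw [hYT, le_div_iff₀ ha0]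
      calc min r (r / Real.sqrt a) ^ 2 * a ≤ (r ^ 2 / a) * a :=
            mul_le_mul_of_nonneg_right (h1.trans h2.le) ha0.le
        _ = r ^ 2 := by field_simp
        _ ≤ X.T := hrT
  -- the local `L³` bound for `Y` on `(Y.T − r₁², Y.T) × B_{r₁}(x₀)`
  have hL3Y : ∀ s ∈ Ioo (Y.T - r₁ ^ 2) Y.T,
      ∫⁻ x in ball x₀ r₁, ‖Y.u s x‖ₑ ^ 3 ≤ ((ENNReal.ofReal a) ^ 3 * C : ℝ≥0∞) := by
    intro s hs
    have has : a * s ∈ Ioo (X.T - r ^ 2) X.T := by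
      constructor
      · have h1 : a * (Y.T - r₁ ^ 2) < a * s := mul_lt_mul_of_pos_left hs.1 ha0
        rw [hYT, mul_sub, mul_div_cancel₀ _ ha0.ne'] at h1
        linarith
      · have h1 : a * s < a * Y.T := mul_lt_mul_of_pos_left hs.2 ha0
        rwa [hYT, mul_div_cancel₀ _ ha0.ne'] at h1
    have h1 : ∫⁻ x in ball x₀ r₁, ‖Y.u s x‖ₑ ^ 3 = (ENNReal.ofReal a) ^ 3 *
        ∫⁻ x in ball x₀ r₁, ‖X.u (a * s) x‖ₑ ^ 3 := by
      rw [← lintegral_const_mul' _ _ (ENNReal.pow_ne_top ENNReal.ofReal_ne_top)]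
      refine lintegral_congr fun x => ?_
      rw [hYu, enorm_smul, mul_pow, Real.enorm_eq_ofReal ha0.le]
    rw [h1]
    exact mul_le_mul' le_rfl ((lintegral_mono_set (ball_subset_ball hr₁r)).trans (hL3 _ has))
  have hC' : ((ENNReal.ofReal a) ^ 3 * C : ℝ≥0∞) = ((((ENNReal.ofReal a) ^ 3 * C).toNNReal : ℝ≥0) : ℝ≥0∞) :=
    (ENNReal.coe_toNNReal (ENNReal.mul_ne_top (ENNReal.pow_ne_top ENNReal.ofReal_ne_top)
      ENNReal.coe_ne_top)).symm
  rw [hC'] at hL3Y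
  -- backward boundedness of `Y` at `(Y.T, x₀)`, transported back
  obtain ⟨ρ, hρ, B, hB⟩ := Y.isBackwardBoundedAt_of_L3_bound_forced_one hr₁0 hr₁T hL3Y
  -- `X.u t x = a⁻¹ Y.u (t/a) x`; `t ∈ (T − ρ'², T)` with `ρ'² ≤ a ρ²` gives `t/a ∈ (Y.T − ρ², Y.T)`
  obtain ⟨ρ', hρ'0, hρ'ρ, hρ'a⟩ : ∃ ρ' : ℝ, 0 < ρ' ∧ ρ' ≤ ρ ∧ ρ' ^ 2 ≤ a * ρ ^ 2 := by
    refine ⟨min ρ (Real.sqrt a * ρ), lt_min hρ (by positivity), min_le_left _ _, ?_⟩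
    calc min ρ (Real.sqrt a * ρ) ^ 2 ≤ (Real.sqrt a * ρ) ^ 2 :=
          pow_le_pow_left₀ (le_min hρ.le (by positivity)) (min_le_right _ _) 2
      _ = a * ρ ^ 2 := by rw [mul_pow, Real.sq_sqrt ha0.le]
  refine ⟨ρ', hρ'0, a⁻¹ * B, fun t ht x hx => ?_⟩
  have hts : t / a ∈ Ioo (Y.T - ρ ^ 2) Y.T := by
    rw [hYT]
    constructor
    · rw [lt_div_iff₀ ha0, sub_mul, div_mul_cancel₀ _ ha0.ne']
      nlinarith [ht.1]
    · exact div_lt_div_of_pos_right ht.2 ha0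
  have h := hB (t / a) hts x (ball_subset_ball hρ'ρ hx)
  rw [hYu, mul_div_cancel₀ _ ha0.ne', norm_smul, Real.norm_of_nonneg ha0.le] at h
  calc ‖X.u t x‖ = a⁻¹ * (a * ‖X.u t x‖) := by field_simp
    _ ≤ a⁻¹ * B := mul_le_mul_of_nonneg_left h (inv_pos.2 ha0).le

/-- **`L³` CONCENTRATES AT EVERY SINGULAR POINT, WITH THE CLAY FORCE** (`ν > 0`; no named fact): if
`u` is not backward bounded at `(T, x₀)`, then for every `0 < r` with `r² ≤ T` and every `C` there is
`t ∈ (T − r², T)` with `∫_{B_r(x₀)} |u(t)|³ > C` — the forced twin of g7's `L3_concentration`.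
[cite: EscauriazaSereginSverak2003, Thm. 1.4] [cite: AlbrittonBarker2019, Thm 1.2] -/
theorem L3_concentration_forced {ν : ℝ} (X : ClayBlowup ν) (hν : 0 < ν)
    {x₀ : EuclideanSpace ℝ (Fin 3)} (hx₀ : ¬ IsBackwardBoundedAt X.u X.T x₀) {r : ℝ} (hr : 0 < r)
    (hrT : r ^ 2 ≤ X.T) (C : ℝ≥0) :
    ∃ t ∈ Ioo (X.T - r ^ 2) X.T, (C : ℝ≥0∞) < ∫⁻ x in ball x₀ r, ‖X.u t x‖ₑ ^ 3 := by
  by_contra h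
  push Not at h
  exact hx₀ (X.isBackwardBoundedAt_of_L3_bound_forced hν hr hrT h)

/-! ## §3 The a.e.-in-time form (g7's interface) -/

/-- **From an a.e.-in-time local `L³` bound to an every-time one** (continuity of the classical
solution below `T` and Fatou): if `∫_{B_r(x₀)} |u(t)|³ ≤ C` for a.e. `t ∈ (T − r², T)`, then for every
such `t`. [folklore] [cite: EscauriazaSereginSverak2003, §3] -/
theorem setLIntegral_cube_le_of_ae {ν : ℝ} (X : ClayBlowup ν) {x₀ : EuclideanSpace ℝ (Fin 3)} {r : ℝ}
    (hrT : r ^ 2 ≤ X.T) {C : ℝ≥0}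
    (hL3 : ∀ᵐ t ∂(volume.restrict (Ioo (X.T - r ^ 2) X.T)), ∫⁻ x in ball x₀ r, ‖X.u t x‖ₑ ^ 3 ≤ C)
    {t : ℝ} (ht : t ∈ Ioo (X.T - r ^ 2) X.T) : ∫⁻ x in ball x₀ r, ‖X.u t x‖ₑ ^ 3 ≤ C := by
  -- good times are dense: pick `t_n → t` with the bound
  have hbad : volume ({t' | ¬ ∫⁻ x in ball x₀ r, ‖X.u t' x‖ₑ ^ 3 ≤ C} ∩ Ioo (X.T - r ^ 2) X.T) = 0 := by
    have h := (ae_restrict_iff' measurableSet_Ioo).1 hL3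
    rw [ae_iff] at h
    convert h using 2
    ext t'
    simp only [mem_inter_iff, mem_setOf_eq, Classical.not_imp]
    tauto
  have hgood : ∀ n : ℕ, ∃ t' ∈ Ioo (X.T - r ^ 2) X.T, |t' - t| < 1 / ((n : ℝ) + 1) ∧
      ∫⁻ x in ball x₀ r, ‖X.u t' x‖ₑ ^ 3 ≤ C := by
    intro n
    have hδ : (0 : ℝ) < 1 / ((n : ℝ) + 1) := by positivity
    set I : Set ℝ := Ioo (max (X.T - r ^ 2) (t - 1 / ((n : ℝ) + 1))) (min X.T (t + 1 / ((n : ℝ) + 1)))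
      with hI
    have hIpos : 0 < volume I := by
      rw [hI, Real.volume_Ioo]
      exact ENNReal.ofReal_pos.2 (by
        have h1 : max (X.T - r ^ 2) (t - 1 / ((n : ℝ) + 1)) < t := max_lt ht.1 (by linarith)
        have h2 : t < min X.T (t + 1 / ((n : ℝ) + 1)) := lt_min ht.2 (by linarith)
        linarith)
    have hIsub : I ⊆ Ioo (X.T - r ^ 2) X.T := fun t' ht' =>
      ⟨(le_max_left _ _).trans_lt ht'.1, ht'.2.trans_le (min_le_left _ _)⟩
    have hne : (I \ {t' | ¬ ∫⁻ x in ball x₀ r, ‖X.u t' x‖ₑ ^ 3 ≤ C}).Nonempty := by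
      apply nonempty_of_measure_ne_zero
      intro h0
      have h1 : volume I ≤ volume (I \ {t' | ¬ ∫⁻ x in ball x₀ r, ‖X.u t' x‖ₑ ^ 3 ≤ C}) +
          volume ({t' | ¬ ∫⁻ x in ball x₀ r, ‖X.u t' x‖ₑ ^ 3 ≤ C} ∩ Ioo (X.T - r ^ 2) X.T) := by
        refine (measure_mono ?_).trans (measure_union_le _ _)
        intro t' ht'
        by_cases hb : ∫⁻ x in ball x₀ r, ‖X.u t' x‖ₑ ^ 3 ≤ C
        · exact Or.inl ⟨ht', fun h => h hb⟩
        · exact Or.inr ⟨hb, hIsub ht'⟩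
      rw [h0, hbad, zero_add] at h1
      exact (not_le.2 hIpos) h1
    obtain ⟨t', ht'I, ht'g⟩ := hne
    refine ⟨t', hIsub ht'I, ?_, not_not.1 ht'g⟩
    rw [abs_lt]
    have h1 := ht'I.1; have h2 := ht'I.2
    constructor
    · linarith [le_max_right (X.T - r ^ 2) (t - 1 / ((n : ℝ) + 1))]
    · linarith [min_le_right X.T (t + 1 / ((n : ℝ) + 1))]
  choose tn htn hdist hbd using hgood
  have htlim : Tendsto tn atTop (𝓝 t) := by
    rw [Metric.tendsto_atTop]
    intro ε hε
    obtain ⟨N, hN⟩ := exists_nat_one_div_lt hε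
    refine ⟨N, fun n hn => ?_⟩
    rw [Real.dist_eq]
    refine (hdist n).trans_le (le_trans ?_ hN.le)
    exact one_div_le_one_div_of_le (by positivity) (by exact_mod_cast Nat.succ_le_succ hn)
  -- Fatou in `x` along `t_n → t` (continuity of `u` in time at fixed `x`)
  have hcont : ∀ x, Tendsto (fun n => ‖X.u (tn n) x‖ₑ ^ 3) atTop (𝓝 (‖X.u t x‖ₑ ^ 3)) := by
    intro x
    have hc : ContinuousAt (fun τ => X.u τ x) t := by
      have hmem : Ico 0 X.T ×ˢ (univ : Set (EuclideanSpace ℝ (Fin 3))) ∈ 𝓝 ((t, x) : ℝ × _) :=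
        Filter.mem_of_superset ((isOpen_Ioo.prod isOpen_univ).mem_nhds
          ⟨(⟨by linarith [ht.1, hrT], ht.2⟩ : t ∈ Ioo 0 X.T), mem_univ _⟩)
          (Set.prod_mono Ioo_subset_Ico_self subset_rfl)
      have h1 : ContinuousAt (uncurry X.u) (t, x) :=
        X.classical.smooth_velocity.continuousOn.continuousAt hmem
      exact h1.comp_of_eq ((continuous_id.prodMk continuous_const).continuousAt) rfl
    exact ENNReal.Tendsto.pow ((hc.tendsto.comp htlim).enorm)
  have hmeas : ∀ n, AEMeasurable (fun x => ‖X.u (tn n) x‖ₑ ^ 3)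
      (volume.restrict (ball x₀ r)) := fun n =>
    ((ENNReal.continuous_pow 3).comp (X.classical.contDiff_velocity
      ⟨by linarith [(htn n).1, hrT], (htn n).2⟩).continuous.enorm).aemeasurable
  calc ∫⁻ x in ball x₀ r, ‖X.u t x‖ₑ ^ 3
      = ∫⁻ x in ball x₀ r, liminf (fun n => ‖X.u (tn n) x‖ₑ ^ 3) atTop :=
        lintegral_congr fun x => ((hcont x).liminf_eq).symm
    _ ≤ liminf (fun n => ∫⁻ x in ball x₀ r, ‖X.u (tn n) x‖ₑ ^ 3) atTop := lintegral_liminf_le' hmeas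
    _ ≤ C := liminf_le_of_frequently_le' (Frequently.of_forall fun n => hbd n)

/-- **`L³` CONCENTRATES AT EVERY SINGULAR POINT, WITH THE CLAY FORCE — g7's a.e.-in-time form**
(`ν > 0`; no named fact): at a point which is not backward bounded, for every `0 < r` (`r² ≤ T`) and
every `C` it is NOT the case that `∫_{B_r(x₀)} |u(t)|³ ≤ C` for a.e. `t ∈ (T − r², T)`. The forced
twin of `ClayBlowup.L3_concentration`. [cite: EscauriazaSereginSverak2003, Thm. 1.4]
[cite: AlbrittonBarker2019, Thm 1.2] -/
theorem L3_concentration_forced_ae {ν : ℝ} (X : ClayBlowup ν) (hν : 0 < ν)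
    {x₀ : EuclideanSpace ℝ (Fin 3)} (hx₀ : ¬ IsBackwardBoundedAt X.u X.T x₀) {r : ℝ} (hr : 0 < r)
    (hrT : r ^ 2 ≤ X.T) (C : ℝ≥0) :
    ¬ ∀ᵐ t ∂(volume.restrict (Ioo (X.T - r ^ 2) X.T)), ∫⁻ x in ball x₀ r, ‖X.u t x‖ₑ ^ 3 ≤ C :=
  fun h => hx₀ (X.isBackwardBoundedAt_of_L3_bound_forced hν hr hrT
    (fun _ ht => X.setLIntegral_cube_le_of_ae hrT h ht))

end ClayBlowup

/-- **Designed blow-ups: `L³` concentrates at every singular point, WITH the force.**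
[cite: EscauriazaSereginSverak2003, Thm. 1.4] -/
theorem DesignedBlowup.L3_concentration_forced {ν : ℝ} (D : DesignedBlowup ν) (hν : 0 < ν)
    {x₀ : EuclideanSpace ℝ (Fin 3)} (hx₀ : ¬ IsBackwardBoundedAt D.u D.T x₀) {r : ℝ} (hr : 0 < r)
    (hrT : r ^ 2 ≤ D.T) (C : ℝ≥0) :
    ∃ t ∈ Ioo (D.T - r ^ 2) D.T, (C : ℝ≥0∞) < ∫⁻ x in ball x₀ r, ‖D.u t x‖ₑ ^ 3 :=
  D.toClayBlowup.L3_concentration_forced hν hx₀ hr hrT C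

end Summit.NavierStokesRegularity.FluidComputer

end
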